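import Literature.NumberTheory.EllipticCurves.Kato2004.MemberHullZetaInputs
import Literature.NumberTheory.EllipticCurves.Kato2004.ZetaLineLocalIndex
import Literature.NumberTheory.EllipticCurves.Kato2004.StrictSelmerH2Count
import HarnessLib

/-!
# Kato 2004 (Astérisque 295) at Kato's member — the CORE re-type of `MemberHullZetaInputs`: the package
# `MemberHullZetaCoreInputs` whose COUNT clause (Prop. 14.16 (2)) is replaced by its two printed inputs,
# the local index of the zeta line at `p` (Lemma 14.18 / Kim §3.2.3) and the order of `𝐇²/X𝐇²`
# ((14.14.2) + (14.9.3)), and whose index clause (Thm. 14.5 (2)) is dropped; the fact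
# `exists_memberHullZetaCoreInputs`

Topic `NumberTheory/EllipticCurves`, sub-directory `Kato2004` (namespace = path).  Seat `bsd-potss-rkm`
(generation 21, cell `bsd-potss`; crux M = item stmt-BirchSwinnertonDyer-19196 `ReducibleKatoMember` of the
routes K9 / K8-t′; held child stmt-BirchSwinnertonDyer-20297 `PublishedInputMemberHullZetaInputs` :=
`Kato2004.exists_memberHullZetaInputs`), executing the planner's re-key request (TARGET R265, T1): a third
sibling of the held named fact `Kato2004.exists_memberHullInputs` (`MemberHullInputs.lean`) after the
zeta-only re-type `Kato2004.exists_memberHullZetaInputs` (`MemberHullZetaInputs.lean`, p519008).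

WHY.  Seat rkm g17–g20 proved Kato's level-`0` Poitou–Tate count (the proof of Prop. 14.16 (2), pp.
244–245) in the kernel (`Theorems/KatoDescentPotSupersingularKatoFiniteLevel*`, `…ASide*`, all
`--supports 19196`): modulo the cell-wide Poitou–Tate named fact `poitouTate_selmerStructure_duality ℚ`, the
COUNT clause of `MemberHullZetaInputs`

  `ord_p #Ш(W)[p^∞] + v_p(Tam W) + ord_p [A : Λ·ι(𝐲̄)] ≤ ord_p(L(W,1)/Ω) + v_p(λ(0)) + ord_p #(𝐇²/X𝐇²) + 3·ord_p #W(ℚ)_tors`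

follows from exactly two printed statements that are NOT that count: (b′) the LOCAL INDEX of the zeta
line at `p`, `[H¹(ℚ_p,T)/H¹_f(ℚ_p,T) : ȳ₀] = p^e` with
`e = ord_p(L(W,1)/Ω) + v_p(λ(0)) + ord_p #W(ℚ_p)[p^∞] − v_p(c_p)` (Kato's `ν` of Prop. 14.16 (2), Lemma 14.18;
C.-H. Kim AJM 148 §3.2.3: `exp*_ω(H¹(ℚ_p,T_pW)) = c_p · p^{−ord_p #W(ℚ_p)[p^∞]} · ℤ_p` at an additive `p`;
Thm. 12.5 (1) + Lemma 13.10 (1): `exp*_ω(ȳ₀) = λ(0) · u · L(W,1)/Ω`) — typed `ZetaLineOrthIndexAt`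
(`ZetaLineLocalIndex.lean`, the one-directional pairing form, weaker than the printed equality); and
(c2′) the ORDER OF `𝐇²/X𝐇²`: `#(𝐇²/X𝐇²) · #W(ℚ)[p^∞] = #Sel_str(ℚ, W[p^∞]) · #W(ℚ_p)[p^∞]` ((14.14.2)
`𝐇²/X𝐇² ≅ H²(ℤ[1/p], T)` + the count of `H²(ℤ[1/p],T)` through (14.9.3)) — typed `KatoH2CountAt`
(`StrictSelmerH2Count.lean`).  The clause `index_ne_zero` (Thm. 14.5 (2)) follows from (b′) (a class whose
zeta line has finite local index is not torsion) and the tree's (R0).  So: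

* `MemberHullZetaCoreInputs W p κ γ I 𝐲` := `MemberHullZetaInputs` MINUS the clauses `index_ne_zero`,
  `count`, PLUS the clauses `zetaLineIndex` ((b′), displayed with the rationality of `L(W,1)/Ω` and the
  value of `e`) and `katoH2Count` ((c2′) for `n = #(𝐇²/X𝐇²)`); every other field — the hull `j : 𝐇¹_Γ ↪ F`,
  `z`, `λ` with `j 𝐲 = λ • z`, `λ(0) ≠ 0`, the abstract `𝐇²`, the pinned `A = H¹(ℤ[1/p],T)`, the maps of
  (14.14.1) with the pin of `ι`, Thm. 12.5 (3) off `(p)`, `μ(𝐇²) = 0` — has the SAME name, type and pin;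
* `exists_memberHullZetaCoreInputs` := the outer text of `exists_memberHullZetaInputs` VERBATIM with
  `MemberHullZetaCoreInputs` for `MemberHullZetaInputs`;
* term-level conversions `MemberHullZetaCoreInputs.toMemberHullZetaInputs` (supply `index_ne_zero`, `count`)
  and `MemberHullZetaInputs.toMemberHullZetaCoreInputs` (supply the two new clauses).

The kernel theorems `MemberHullZetaCoreInputs → (Poitou–Tate fact) → MemberHullZetaInputs` on every pin with
`W(ℚ)`, `Ш(W)[p^∞]` finite, and `exists_memberHullZetaCoreInputs → poitouTate_selmerStructure_duality ℚ →
rank_eq_analyticRank_of_analyticRank_le_one → exists_memberHullZetaInputs`, are Summits-side (they use the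
crux-M ledger `Theorems/KatoDescentPotSupersingularASide*`, which a Literature file cannot import):
`Theorems/KatoDescentPotSupersingularMemberHullZetaInputsOfCore.lean` (seat rkm g21).

WHY CLAUSES AND NOT FREE-STANDING NODES.  (b′) involves `λ(0)` and (c2′) involves `𝐇²`, both EXISTENTIAL
fields of the package: a statement "for every package, (b′)/(c2′)" would be false (take `z := j 𝐲`,
`λ := 1`; pad `𝐇²`), so the two printed inputs are typed as clauses of the same structure, coupled to the
fields they speak about — exactly as the COUNT clause was.

HONEST SCOPE.  Nothing is booked by the re-type: `exists_memberHullZetaCoreInputs` is the transcription of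
Kato Thm. 12.5 (1)–(3) / 12.6 / 13.10 (1) / 13.14 / (14.14.1)–(14.14.2) with (14.9.3) / Lemma 14.18 with
Kim §3.2.3 + Wuthrich L.14 AT KATO'S MEMBER (Kato's Euler system, explicit reciprocity — no `_holds`
expected, size XL); relative to `exists_memberHullZetaInputs` it replaces one reading (the assembled count)
by the two printed statements the count is assembled from, and drops a clause that is a theorem.  WEAKER
THAN PRINT (the identity of `F`, `𝐇²` is forgotten; (b′) is one direction of an equality), never stronger.
BSD is not advanced; see `MemberHullInputs.lean` ("WHAT THE ABSTRACT FIELDS DO AND DO NOT PIN") for what a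
package of this kind certifies.  Referee flag `Kato-12.6-13.10-14.18-14.14.2-member-reading-reducible`.

## References

* K. Kato, *p-adic Hodge theory and values of zeta functions of modular forms*, Astérisque 295 (2004):
  §8.2–8.3 (pp. 180–181), (12.2.1) (p. 220), Thm. 12.4, Thm. 12.5 (pp. 221–222), Thm. 12.6, Rem. 12.7
  (p. 222), 13.9, Lemma 13.10 (1) (pp. 229–230), 13.14 (p. 234), §14.1 (p. 235), (14.9.3) (p. 240),
  §14.14 (14.14.1)–(14.14.2) (p. 243), Prop. 14.16 (2) and its proof (pp. 244–245), §14.17, Lemma 14.18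
  (pp. 247–248) — store key `paper:doi-10-24033-ast-639`, pp. 240–248 re-read by this seat. [Kato2004Asterisque]
* C.-H. Kim, Amer. J. Math. 148 (2026), §3.2.3 display before Thm. 3.7. [Kim2022StructureSelmer]
* C. Wuthrich, Doc. Math. 19 (2014), Lemma 12 (p. 395), Lemma 14 (p. 396). [Wuthrich2014]
* R. Greenberg, LNM 1716 (1999), Prop. 4.13 and §3. [GreenbergLNM1716]
* J. S. Milne, *Arithmetic Duality Theorems* (2006), I Cor. 2.3, Thm. 4.10. [MilneADT2006]
* Tree: `MemberHullZetaInputs.lean` (the sibling), `ZetaLineLocalIndex.lean` (`ZetaLineOrthIndexAt`),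
  `StrictSelmerH2Count.lean` (`KatoH2CountAt`), `LocPKummerLog.lean` (`layerZeroToTop`, `primePlace`).
-/

noncomputable section

open scoped Classical NumberField TensorProduct
open Field IsDedekindDomain CongruenceSubgroup
open Literature.NumberTheory.GaloisRepresentations
open Literature.NumberTheory.EllipticCurves Literature.NumberTheory.EllipticCurves.ModularForms
open Literature.NumberTheory.EllipticCurves.Kato2004
open Literature.NumberTheory.EllipticCurves.Kato2004.EulerSystemValues Rat.HeightOneSpectrum
open Literature.NumberTheory.EllipticCurves.IwasawaAlgebra

namespace Literature.NumberTheory.EllipticCurves.Kato2004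

section Package

variable (W : WeierstrassCurve ℚ) [W.IsElliptic] (p : ℕ) [Fact p.Prime]
  [ContinuousSMul ℤ_[p] (W.tateModule p)] (κ : ZpExtension ℚ p) (γ : absoluteGaloisGroup ℚ)
  (I : IwasawaH1Data W p κ γ) (y : I.H)

/-- **Kato's rank-`0` descent inputs at his own lattice, CORE re-type of `MemberHullZetaInputs` —
hypothesis structure (a package of the printed statements; nothing asserted).**  For an elliptic curve
`W/ℚ` (intended: Kato's member `W_K`, `T_pW ≅ V_{ℤ_p}(f)(1)`), a pinned Iwasawa cohomology
`I : IwasawaH1Data W p κ γ` and an element `y : I.H` (the `Λ`-adic class of a `ZetaBody` family): the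
reflexive hull `j : I.H ↪ F` (13.14 / Wuthrich L.12), Kato's normalised zeta element `z = z_γ⁰ ∈ F`,
`z ≠ 0`, `F/Λz` torsion (Thm. 12.5 (1)(2)), the multiplier `lam ∈ Λ` of Lemma 13.10 (1) with
`j y = lam • z`, `lam(0) ≠ 0`; the abstract `H2 = 𝐇²(T)⁰`, finitely generated torsion ((12.2.1),
Thm. 12.4 (1)); the module `A = H¹(ℤ[1/p],T)` PINNED to `integralH1 (tateRep W p) p (κ.layerSubgroup 0)`;
the maps `ι`, `π` of (14.14.1) with `π` surjective, exactness in the middle and the PIN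
`toH1 ∘ ι ∘ mk = proj₀`; Thm. 12.5 (3) + Rem. 12.7 off `(p)`; `μ(𝐇²(T)⁰) = 0` (Wuthrich L.14, reducible
`W[p]`); AND, replacing the COUNT of the sibling: (b′) the LOCAL INDEX OF THE ZETA LINE at `p` —
`L(W,1)/Ω(W)` is rational, `= q`, and for `e = ord_p q + v_p(λ(0)) + ord_p #W(ℚ_p)[p^∞] − v_p(c_p)` (a natural
number) the bottom class `y₀ = proj₀ y` (moved to `H¹(⊤, T_pW)` by `layerZeroToTop`) satisfies
`ZetaLineOrthIndexAt W p y₀ e` (Prop. 14.16 (2) `ν` / Lemma 14.18 with Kim §3.2.3 and Thm. 12.5 (1),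
Lemma 13.10 (1)); (c2′) the ORDER OF `𝐇²/X𝐇²` — `KatoH2CountAt W p #(coinvariants H2)` ((14.14.2) +
(14.9.3)).  EXACTLY the field list of `MemberHullZetaInputs` with `index_ne_zero`, `count` removed and
`zetaLineIndex`, `katoH2Count` added (module docstring); same names, types, pins otherwise.
[cite: Kato2004Asterisque, Thm. 12.4 (1) (p. 221), Thm. 12.5 (1)–(3) (pp. 221–222), Thm. 12.6 and Rem. 12.7 (p. 222), Lemma 13.10 (1) (p. 230), 13.14 (p. 234), §14.14 (14.14.1)–(14.14.2) (p. 243), (14.9.3) (p. 240), Prop. 14.16 (2) (p. 244), Lemma 14.18 (pp. 247–248)]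
[cite: Kim2022StructureSelmer, §3.2.3 display before Thm. 3.7 (PDF p. 16)]
[cite: Wuthrich2014, Lemma 12 (p. 395), Lemma 14 (p. 396)] [cite: MilneADT2006, Ch. I, Cor. 2.3 and Thm. 4.10] -/
structure MemberHullZetaCoreInputs : Type 1 where
  /-- The reflexive hull `F = (𝐇¹_Γ)^{**}` (13.14 / Wuthrich L.12), abstract. -/
  F : Type
  [addCommGroupF : AddCommGroup F]
  [moduleF : _root_.Module (IwasawaAlgebra p) F]
  /-- `F` is finitely generated. -/
  finite_F : Module.Finite (IwasawaAlgebra p) F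
  /-- `F` is torsion free. -/
  torsionFree_F : NoZeroSMulDivisors (IwasawaAlgebra p) F
  /-- The inclusion `𝐇¹_Γ ↪ (𝐇¹_Γ)^{**}`. -/
  j : I.H →ₗ[IwasawaAlgebra p] F
  /-- `j` is injective. -/
  j_injective : Function.Injective j
  /-- The hull has finite (pseudo-null) cokernel. -/
  finite_coker : Finite (F ⧸ LinearMap.range j)
  /-- Kato's normalised zeta element `z_γ⁰` (`γ^+` a `ℤ_p`-basis of `T(−1)^+`), in the hull
  (Thm. 12.6 + 13.14). -/
  z : F
  /-- `z_γ⁰ ≠ 0` (Thm. 12.5 (1) with 13.5 / 14.5 (2)). -/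
  z_ne_zero : z ≠ 0
  /-- Thm. 12.5 (2) with 12.4 (2): `F/Λz` is torsion (rank one). -/
  isTorsion_quotient : Module.IsTorsion (IwasawaAlgebra p) (F ⧸ (IwasawaAlgebra p) ∙ z)
  /-- Lemma 13.10 (1): the multiplier `λ ∈ Λ` of the `(c,d,a(A))`-class. -/
  lam : IwasawaAlgebra p
  /-- Lemma 13.10 (1): `j y = λ • z_γ⁰`. -/
  j_y : j y = lam • z
  /-- `λ(0) ≠ 0` (the admissible `(c,d,a,A)` chosen with `γ_*^+ ≠ 0`). -/
  lam_constantCoeff_ne_zero : PowerSeries.constantCoeff lam ≠ 0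
  /-- `H2 = 𝐇²(T)⁰`, abstract. -/
  H2 : Type
  [addCommGroupH2 : AddCommGroup H2]
  [moduleH2 : _root_.Module (IwasawaAlgebra p) H2]
  /-- (12.2.1): `𝐇²` is finitely generated. -/
  finite_H2 : Module.Finite (IwasawaAlgebra p) H2
  /-- Thm. 12.4 (1): `𝐇²` is torsion. -/
  isTorsion_H2 : Module.IsTorsion (IwasawaAlgebra p) H2
  /-- `A = H¹(ℤ[1/p], T)` as a `Λ`-module (through the augmentation), pinned by `toH1`. -/
  A : Type
  [addCommGroupA : AddCommGroup A]
  [moduleA : _root_.Module (IwasawaAlgebra p) A]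
  /-- The PIN of `A`: an additive map to `H¹(ℚ, T_pW)` at the bottom layer `κ.layerSubgroup 0 = Γ_ℚ` … -/
  toH1 : A →+ H1 (tateRep W p) (κ.layerSubgroup 0)
  /-- … injective … -/
  toH1_injective : Function.Injective toH1
  /-- … with image exactly the integral classes `H¹(ℤ[1/p], T_pW)` (§8.2, Lemma 8.5) … -/
  mem_range_toH1_iff : ∀ x : H1 (tateRep W p) (κ.layerSubgroup 0),
    x ∈ Set.range toH1 ↔ x ∈ integralH1 (tateRep W p) p (κ.layerSubgroup 0)
  /-- … and `Λ` acting on `A` through the augmentation `g ↦ g(0)` (so `X` acts as `0`). -/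
  toH1_smul : ∀ (g : IwasawaAlgebra p) (a : A), toH1 (g • a) = PowerSeries.constantCoeff g • toH1 a
  /-- (14.14.1), first map `𝐇¹_Γ/X𝐇¹_Γ → H¹(ℤ[1/p],T)`. -/
  ι : coinvariants p I.H →ₗ[IwasawaAlgebra p] A
  /-- (14.14.1), second map `H¹(ℤ[1/p],T) → 𝐇²[X]`. -/
  π : A →ₗ[IwasawaAlgebra p] invariants p H2
  /-- (14.14.1): `π` surjective. -/
  π_surjective : Function.Surjective π
  /-- (14.14.1): exact in the middle. -/
  exact_ι_π : Function.Exact ι π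
  /-- The PIN of `ι`: `ι(x mod X) = proj₀ x` in `H¹(ℚ, T_pW)` (§13.8 / (14.14.1); `IwasawaH1Data.projZero`). -/
  toH1_ι : ∀ x : I.H, toH1 (ι (Submodule.Quotient.mk x)) = I.proj 0 x
  /-- Thm. 12.5 (3) with Rem. 12.7 (potentially good `p`: `𝐇²_loc = 0`), on the `Δ`-trivial component:
  `ℓ_𝔮(𝐇²) ≤ ℓ_𝔮(F/Λz_γ)` at every height-one `𝔮 ≠ (p)`. -/
  divisibility_offP : ∀ 𝔮 : PrimeSpectrum (IwasawaAlgebra p), 𝔮.asIdeal.height = 1 →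
    𝔮.asIdeal ≠ augIdealP p →
      Module.lengthAt (IwasawaAlgebra p) H2 𝔮 ≤
        Module.lengthAt (IwasawaAlgebra p) (F ⧸ (IwasawaAlgebra p) ∙ z) 𝔮
  /-- Wuthrich 2014 Lemma 14 + global duality (reducible `W[p]`, `p` odd): `μ(𝐇²(T)⁰) = 0`. -/
  mu_H2 : muInvariant p H2 = 0
  /-- (b′) THE LOCAL INDEX OF THE ZETA LINE AT `p` (Prop. 14.16 (2) `ν`, Lemma 14.18; Kim §3.2.3;
  Thm. 12.5 (1) with Lemma 13.10 (1)): `L(W,1)/Ω(W) = q ∈ ℚ`, the exponent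
  `e = ord_p q + v_p(λ(0)) + ord_p #W(ℚ_p)[p^∞] − v_p(c_p)` is a natural number, and the bottom class
  `y₀ = proj₀ y` has local index (at least) `p^e` at `p` in the pairing form `ZetaLineOrthIndexAt`
  (`[H¹(ℚ_p,T)/H¹_f(ℚ_p,T) : ℤ_p ȳ₀] = p^e` in print). -/
  zetaLineIndex : ∃ q : ℚ, W.entireLFunction 1 / (W.realPeriodRat : ℂ) = (q : ℂ) ∧
    ∃ e : ℕ, (e : ℤ) = padicValRat p q + ((PowerSeries.constantCoeff lam).valuation : ℤ) +
        (padicValNat p (Nat.card (AddCommGroup.primaryComponent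
          (W.baseChange ((primePlace p).adicCompletion ℚ)).toAffine.Point p)) : ℤ) -
        (padicValNat p ((W.baseChange ((primePlace p).adicCompletion ℚ)).localTamagawaNumber
          ((primePlace p).adicCompletionIntegers ℚ)) : ℤ) ∧
      ZetaLineOrthIndexAt W p (layerZeroToTop W p κ (I.proj 0 y)) e
  /-- (c2′) THE ORDER OF `𝐇²/X𝐇²` ((14.14.2) `𝐇²/X𝐇² ≅ H²(ℤ[1/p],T)` + the count of `H²(ℤ[1/p],T)` through
  (14.9.3)): `#(𝐇²/X𝐇²) · #W(ℚ)[p^∞] = #Sel_str(ℚ, W[p^∞]) · #W(ℚ_p)[p^∞]`. -/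
  katoH2Count : KatoH2CountAt W p (Nat.card (coinvariants p H2))

attribute [instance] MemberHullZetaCoreInputs.addCommGroupF MemberHullZetaCoreInputs.moduleF
  MemberHullZetaCoreInputs.addCommGroupH2 MemberHullZetaCoreInputs.moduleH2
  MemberHullZetaCoreInputs.addCommGroupA MemberHullZetaCoreInputs.moduleA

end Package

/-! ## Term-level conversions (the arithmetic is Summits-side) -/

section Conversions

variable {W : WeierstrassCurve ℚ} [W.IsElliptic] {p : ℕ} [Fact p.Prime]
  [ContinuousSMul ℤ_[p] (W.tateModule p)] {κ : ZpExtension ℚ p} {γ : absoluteGaloisGroup ℚ}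
  {I : IwasawaH1Data W p κ γ} {y : I.H}

/-- **From a core package to a `MemberHullZetaInputs` package, GIVEN the two dropped clauses**
`index_ne_zero` (Thm. 14.5 (2)) and `count` (Prop. 14.16 (2)) — both are theorems of the core package
modulo the Poitou–Tate fact, Summits-side; here they are hypotheses. [cite: Kato2004Asterisque, Thm. 14.5 (2) (p. 236) and Prop. 14.16 (2) (p. 244)] -/
def MemberHullZetaCoreInputs.toMemberHullZetaInputs (Z : MemberHullZetaCoreInputs W p κ γ I y)
    (hidx : Nat.card (Z.A ⧸ (IwasawaAlgebra p) ∙ Z.ι (Submodule.Quotient.mk y)) ≠ 0)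
    (hcount : ∃ q : ℚ, W.entireLFunction 1 / (W.realPeriodRat : ℂ) = (q : ℂ) ∧
      (padicValNat p (Nat.card (AddCommGroup.primaryComponent W.sha p)) : ℤ) +
          padicValNat p W.tamagawaProduct +
          padicValNat p (Nat.card (Z.A ⧸ (IwasawaAlgebra p) ∙ Z.ι (Submodule.Quotient.mk y))) ≤
        padicValRat p q + ((PowerSeries.constantCoeff Z.lam).valuation : ℤ) +
          padicValNat p (Nat.card (coinvariants p Z.H2)) + 3 * (padicValNat p W.torsionOrder : ℤ)) :
    MemberHullZetaInputs W p κ γ I y where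
  F := Z.F
  finite_F := Z.finite_F
  torsionFree_F := Z.torsionFree_F
  j := Z.j
  j_injective := Z.j_injective
  finite_coker := Z.finite_coker
  z := Z.z
  z_ne_zero := Z.z_ne_zero
  isTorsion_quotient := Z.isTorsion_quotient
  lam := Z.lam
  j_y := Z.j_y
  lam_constantCoeff_ne_zero := Z.lam_constantCoeff_ne_zero
  H2 := Z.H2
  finite_H2 := Z.finite_H2
  isTorsion_H2 := Z.isTorsion_H2
  A := Z.A
  toH1 := Z.toH1
  toH1_injective := Z.toH1_injective
  mem_range_toH1_iff := Z.mem_range_toH1_iff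
  toH1_smul := Z.toH1_smul
  ι := Z.ι
  π := Z.π
  π_surjective := Z.π_surjective
  exact_ι_π := Z.exact_ι_π
  toH1_ι := Z.toH1_ι
  divisibility_offP := Z.divisibility_offP
  mu_H2 := Z.mu_H2
  index_ne_zero := hidx
  count := hcount

/-- **From a `MemberHullZetaInputs` package to a core package, GIVEN the two printed inputs (b′), (c2′)**
(they are finer than the assembled count and are not derivable from it).
[cite: Kato2004Asterisque, Lemma 14.18 (pp. 247–248) and §14.14 (14.14.2) (p. 243)] -/
def MemberHullZetaInputs.toMemberHullZetaCoreInputs (D : MemberHullZetaInputs W p κ γ I y)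
    (hb : ∃ q : ℚ, W.entireLFunction 1 / (W.realPeriodRat : ℂ) = (q : ℂ) ∧
      ∃ e : ℕ, (e : ℤ) = padicValRat p q + ((PowerSeries.constantCoeff D.lam).valuation : ℤ) +
          (padicValNat p (Nat.card (AddCommGroup.primaryComponent
            (W.baseChange ((primePlace p).adicCompletion ℚ)).toAffine.Point p)) : ℤ) -
          (padicValNat p ((W.baseChange ((primePlace p).adicCompletion ℚ)).localTamagawaNumber
            ((primePlace p).adicCompletionIntegers ℚ)) : ℤ) ∧
        ZetaLineOrthIndexAt W p (layerZeroToTop W p κ (I.proj 0 y)) e)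
    (hc : KatoH2CountAt W p (Nat.card (coinvariants p D.H2))) :
    MemberHullZetaCoreInputs W p κ γ I y where
  F := D.F
  finite_F := D.finite_F
  torsionFree_F := D.torsionFree_F
  j := D.j
  j_injective := D.j_injective
  finite_coker := D.finite_coker
  z := D.z
  z_ne_zero := D.z_ne_zero
  isTorsion_quotient := D.isTorsion_quotient
  lam := D.lam
  j_y := D.j_y
  lam_constantCoeff_ne_zero := D.lam_constantCoeff_ne_zero
  H2 := D.H2
  finite_H2 := D.finite_H2
  isTorsion_H2 := D.isTorsion_H2
  A := D.A
  toH1 := D.toH1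
  toH1_injective := D.toH1_injective
  mem_range_toH1_iff := D.mem_range_toH1_iff
  toH1_smul := D.toH1_smul
  ι := D.ι
  π := D.π
  π_surjective := D.π_surjective
  exact_ι_π := D.exact_ι_π
  toH1_ι := D.toH1_ι
  divisibility_offP := D.divisibility_offP
  mu_H2 := D.mu_H2
  zetaLineIndex := hb
  katoH2Count := hc

end Conversions

/-! ## The named fact: the core package exists at Kato's member -/

/-- **Kato 2004, Thm. 12.5 (1)–(3), 12.6 + Lemma 13.10 (1) + 13.14, §14.14 (14.14.1)–(14.14.2) with the
count of `H²(ℤ[1/p],T)` through (14.9.3), Prop. 14.16 (2)'s local index `ν` / Lemma 14.18 (with C.-H.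
Kim §3.2.3 at an additive `p`), (12.2.1) and Thm. 12.4 (1) for `𝐇²`, and Wuthrich 2014 Lemma 14, AT KATO'S
LATTICE `T = V_{ℤ_p}(f)(1)`: the CORE rank-`0` descent inputs EXIST at Kato's member.**  For every
globally minimal elliptic curve `W/ℚ` and every prime `p ≠ 2` of ADDITIVE, POTENTIALLY GOOD
(`0 ≤ ord_p j(W)`) reduction with `W[p]` REDUCIBLE, `L(W,1) ≠ 0` and `Ш(W/ℚ)` finite, there is a GLOBALLY
MINIMAL curve `W_K/ℚ`, `ℚ`-isogenous to `W` (Kato's member: `T_pW_K ≅ V_{ℤ_p}(f)(1)`, §8.3 + *AEC*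
III.4.12 — displayed existentially), such that for the newform `f` of `W` and every family of complex
embeddings `ι` there are witnesses `(κ', Λ', c, d, a, A, z, x)` with `κ' ≠ 0`, `A ≥ 1`, `(c, 6pA) = 1`,
`(d, 6pN) = 1` satisfying `ZetaBody W_K p f ι κ' Λ' c d a A z x`, AND for every cyclotomic `ℤ_p`-tower `κ`
with topological generator `γ`, every `I : IwasawaH1Data W_K p κ γ` and THE element `𝐲 ∈ I.H` lifting
the corestricted `p`-power levels (`IwasawaH1Data.existsUnique_lift_of_zetaBody`), the structure
`MemberHullZetaCoreInputs W_K p κ γ I 𝐲` is inhabited.  VERBATIM the outer text of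
`exists_memberHullZetaInputs` with `MemberHullZetaCoreInputs` for `MemberHullZetaInputs`: the sibling's
clause `index_ne_zero` (Thm. 14.5 (2)) and its COUNT (Prop. 14.16 (2)) are theorems of the core package
modulo the Poitou–Tate named fact `poitouTate_selmerStructure_duality ℚ` (Summits-side kernel theorem
`exists_memberHullZetaInputs_of_coreInputs`, seat rkm g21).  A CONSTRUCTION fact (D-0014): weaker than
print (the identity of `F`, `𝐇²` is forgotten; (b′) is one direction of the printed index equality), never
stronger; nothing asserted; no `_holds` expected (size XL: Kato's Euler system, explicit reciprocity).
Referee flag `Kato-12.6-13.10-14.18-14.14.2-member-reading-reducible`.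
[cite: Kato2004Asterisque, §8.3 (p. 181), (12.2.1) (p. 220), Thm. 12.4 (1) (p. 221), Thm. 12.5 (1)–(3) (pp. 221–222), Thm. 12.6 and Rem. 12.7 (p. 222), 13.9 and Lemma 13.10 (1) (pp. 229–230), 13.14 (p. 234), §14.1 (p. 235), (14.9.3) (p. 240), §14.14 (14.14.1)–(14.14.2) (p. 243), Prop. 14.16 (2) and its proof (pp. 244–245), Lemma 14.18 (pp. 247–248), (8.1.3) (p. 180), Ex. 13.3 (p. 225), Prop. 8.12 (p. 186), Thm. 9.7 (p. 189), Thm. 6.6 (1) (p. 163)]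
[cite: Kim2022StructureSelmer, §3.2.3 display before Thm. 3.7 (PDF p. 16)]
[cite: Wuthrich2014, §3.2 and Lemma 12 (pp. 394–395), Lemma 14 (p. 396)]
[cite: GreenbergLNM1716, Prop. 4.13 and the paragraph following its proof; §3 after Lemma 3.3]
[cite: MilneADT2006, Ch. I, Cor. 2.3 and Thm. 4.10] [cite: SilvermanAEC2009, Prop. III.4.12 with Rem. III.4.13.2] -/
def exists_memberHullZetaCoreInputs : Prop :=
  ∀ (W : WeierstrassCurve ℚ) [W.IsElliptic] [W.IsGloballyMinimal] (p : ℕ) [Fact p.Prime]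
    (hp : p ≠ 2),
    ¬ W.HasGoodReductionAtPrime p → ¬ W.HasMultiplicativeReductionAtPrime p →
    0 ≤ padicValRat p W.j →
    ¬ W.HasIrreducibleModPGaloisRep p →
    W.entireLFunction 1 ≠ 0 → Finite W.sha →
    ∃ (W' : WeierstrassCurve ℚ) (_ : W'.IsElliptic) (_ : W'.IsGloballyMinimal),
      WeierstrassCurve.IsIsogenous W W' ∧
      ∀ [ContinuousSMul ℤ_[p] (W'.tateModule p)] [Module.Free ℤ_[p] (W'.tateModule p)]
        [Module.Finite ℤ_[p] (W'.tateModule p)],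
      ∀ {N : ℕ} [NeZero N] (f : CuspForm (Gamma0 N) 2), IsNewformOf W f →
      ∀ (ι : (m : ℕ) → (CyclotomicField m ℚ →+* ℂ)),
      ∃ (κ' : ℝ) (Λ' : ∀ (k : ℕ) (r : Finset (HeightOneSpectrum (𝓞 ℚ))),
          H1 (tateRep W' p) (cycSubgroup p k r) →ₗ[ℤ_[p]] ℚ_[p] ⊗[ℚ] CyclotomicField (cycLevel p k r) ℚ)
        (c d a : ℤ) (A : ℕ)
        (z : ∀ (k : ℕ) (r : (cyclotomicLevelsRat p (badPlaces c d A N)).Ideals),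
          H1 (tateRep W' p) ((cyclotomicLevelsRat p (badPlaces c d A N)).level k r.1))
        (x : ∀ (k : ℕ) (r : (cyclotomicLevelsRat p (badPlaces c d A N)).Ideals),
          CyclotomicField (cycLevel p k r.1) ℚ),
        κ' ≠ 0 ∧ 0 < A ∧ Int.gcd c (6 * p * A) = 1 ∧ Int.gcd d (6 * p * N) = 1 ∧
        ZetaBody W' p f ι κ' Λ' c d a A z x ∧
        ∀ (κ : ZpExtension ℚ p) (γ : absoluteGaloisGroup ℚ) (hκ : κ.IsCyclotomic),
          κ.IsTopGenerator γ →
          ∀ (I : IwasawaH1Data W' p κ γ) (y : I.H),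
            (∀ n : ℕ, I.proj n y = levelToLayer W' p hκ hp (badPlaces c d A N) n
              (z (n + 1) (cyclotomicLevelsRat p (badPlaces c d A N)).idealOne)) →
            Nonempty (MemberHullZetaCoreInputs W' p κ γ I y)

end Literature.NumberTheory.EllipticCurves.Kato2004

end
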